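import Summits.Langlands.Langlands.Theorems.IrreducibilityBySelfDualityPairLBoundaryJSUnitBoxTranslatePeel
import Summits.Langlands.Langlands.Theorems.IrreducibilityBySelfDualityPairLBoundaryJSUnitBoxTranslateLocalValue
import Summits.Langlands.Langlands.Theorems.IrreducibilityBySelfDualityPairLBoundaryJSThinLastRowTorusPoint
import Literature.NumberTheory.Automorphic.TorusPairIntegrandThinSupport

/-!
# Crux `PairLBoundaryJS` (stmt-Langlands-13622), line `Sketch` — stub `stub_unitBox_translate_productForm` (W4a):
# support collapse and product form of the translated thin pair integrand on the unit box

Summit `Langlands`, sub-problem `Langlands`, helper file under `Theorems/` supporting the crux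
`PairLBoundaryJS` (Arthur–Clozel (1989), Ch. 3, (2.2)), line `Sketch`, registered stub
`stub_unitBox_translate_productForm` (part 3 of 3: parts 1–2 are `…UnitBoxTranslatePeel`, `…UnitBoxTranslateLocalValue`).

The bad-place step of the Rankin–Selberg method for a PAIR of cusp forms on `GL_{n+1}`
(Jacquet–Piatetski-Shapiro–Shalika (1983), (2.7): at a finite place the local integral of suitable data is a
non-zero constant; Cogdell (2004), §4.1: `Ψ = ∏_v Ψ_v` for factorizable data), in the tree's torus
coordinates and abstractly in two functions `W`, `W'` on `GL_{n+1}(𝔸_K)`: `W`, `W'` left `ψ`-equivariant,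
`W` central up to modulus one, both right `K_f(𝔫)`-invariant with the primes of `𝔫` in `T`, `W` spread at every
`v ∈ T` (`IsSpreadWhittakerAt`, with the depth-`m` inequality) and `W'` right `K_v(𝔭^M)`-invariant there, `τ` a
torus element trivial at `T` with last entry `1`, and
`I(Φ_∞, s) = torusPairIntegrandC (W(diag τ ·), W̄'(diag τ ·), thinTestFun Φ_∞ T m, s)`.

* (i) `∫_{B({v ∉ T}) × K} I = ∫_{B(all) × K} I` — `setIntegral_translate_thin_eq_unitBox_univ` (part 1).
* (ii) the product form on `B(all) × K`:
  `I(p) = F((diag a k)_f) · W(diag τ (diag a k)_∞) W̄'(diag τ (diag a k)_∞) Φ_∞(e (diag a k)_∞) |det|^s δ⁻¹` with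
  `F(κ) = 𝟙_{thin}(κ) ∏_{v ∈ T} 𝟙[κ_v ∈ N_v K♯_v]`, `K♯_v = {k ∈ K_v(𝔭^{M_v}) : W(g ι_v(k)) = W(g) ∀ g}`: the local
  value theorem `pair_apply_mul_ofLocal_eq` (part 2) at each `v ∈ T`, peeled one place at a time by
  `pair_eq_prod_mul_pair` (part 1) from the base point `diag τ · ((diag a k)_∞, 1)`, the remaining finite components
  being removed by right `K_f(𝔫)`-invariance; `F ∈ {0, 1}`, `F(1) = 1`, and `F` is right `K_f(𝔪)`-invariant for
  `𝔪 = ∏_{v ∈ T} 𝔭_v^m` (`thinIndicatorGL_mul_of_mem_finitePrincipalCongruenceLevel`, `exists_sharp_mul_iff`);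
  the test-function and weight factors are `thinTestFun_lastRow_torusPoint_succ_eq_of_forall` (with the thin
  indicator of `(diag a k)_f` computed here, `thinIndicatorGL_sndHom_torusPoint_eq_one_of_forall`) and
  `torusWeightC_eq_archTorusWeightC`.

All proofs complete; tree theorems only.

## References

* H. Jacquet, I. I. Piatetski-Shapiro, J. A. Shalika, *Rankin–Selberg convolutions*, Amer. J. Math.
  105 (1983), §2, (2.7) [JacquetPiatetskiShapiroShalika1983].
* J. W. Cogdell, *Analytic theory of L-functions for GL_n*, in *An Introduction to the Langlands
  Program* (2004), §2.3, §4.1 [CogdellAnalyticTheory2004].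
-/

noncomputable section

-- `Summit.Langlands.Langlands.…` (summit = sub-problem name, D-0017 layout) trips `dupNamespace`
set_option linter.dupNamespace false

open scoped MatrixGroups Topology Pointwise ENNReal NNReal ComplexConjugate InnerProductSpace ContDiff
-- the place subtypes indexing `mixedSpace K` are `Fintype` classically (`NormedCommRing (mixedSpace K)`)
open scoped Classical Matrix.Norms.Operator
open NumberField IsDedekindDomain MeasureTheory Measure Matrix Set Filter WithZero
open NumberField.mixedEmbedding
open Literature.NumberTheory.Automorphic AdelicGroupData
open Literature.NumberTheory.GaloisRepresentations (ideleGroup HeckeCharacter)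
open ValuativeRel

-- the automorphic quotient carries the tree's Borel σ-algebra, not Mathlib's quotient σ-algebra
attribute [-instance] Quotient.instMeasurableSpace QuotientGroup.measurableSpace

-- the house local instances, exactly as in `RankinSelbergUnfoldingIdentity`
attribute [local instance] adelicBorel borelSpace_adelic locallyCompactSpace_adelic secondCountableTopology_gl_adelic
  glAdeleBorel borelSpace_glAdele borelSpace_ideleGroup secondCountableTopology_ideleGroup

-- Mathlib idiom: the commutator Lie ring on matrices, to mention `(archGroupGL n K).lie`
attribute [local instance 100] LieRing.ofAssociativeRing

namespace Summit.Langlands.Langlands.Theorems.UnitBoxTranslateProductForm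

/-! ### The thin indicator at a torus point of the unit box -/

section Thin

variable {n : ℕ} {K : Type} [Field K] [NumberField K] {T : Finset (HeightOneSpectrum (𝓞 K))} {m : ℕ}

/-- **On the thin shell the thin indicator of `(diag a k)_f` is `1`** (`a` in the unit box at all finite places):
integrality of the last row is `valued_lastRow_torusPoint_le_one`, the congruence is read on the local components
(`lastRow_succ_apply_adicComponent`). [folklore] -/
theorem thinIndicatorGL_sndHom_torusPoint_eq_one_of_forall {a : Fin (n + 1) → ideleGroup K}
    (ha : a ∈ unitBox (n := n + 1) (K := K) (Set.univ : Set (HeightOneSpectrum (𝓞 K))))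
    (k : ↥(maximalCompactAdelic (n + 1) K))
    (hc : ∀ v ∈ T, ∀ j : Fin (n + 1),
      Valued.v (((localComponent v (torusPoint (n + 1) K (a, k)) : GL (Fin (n + 1)) (v.adicCompletion K)) :
          Matrix (Fin (n + 1)) (Fin (n + 1)) (v.adicCompletion K)) (Fin.last n) j -
        if j = Fin.last n then 1 else 0) ≤ exp (-(m : ℤ))) :
    thinIndicatorGL (n + 1) K T m (GLn.sndHom (n + 1) K (torusPoint (n + 1) K (a, k))) = 1 := by
  have hmem : finLastRow (n + 1) K (GLn.sndHom (n + 1) K (torusPoint (n + 1) K (a, k))) ∈ thinFiniteBox (n + 1) K T m := by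
    rw [finLastRow_sndHom, mem_thinFiniteBox_iff]
    refine ⟨fun j w => (HeightOneSpectrum.mem_adicCompletionIntegers (R := 𝓞 K) K w).2
      (valued_lastRow_torusPoint_le_one (v := w) (fun i => ha w (Set.mem_univ w) i) k j), fun v hv j => ?_⟩
    have h := hc v hv j
    rw [← ThinLastRowTorusPoint.lastRow_succ_apply_adicComponent] at h
    by_cases hj : j = Fin.last n
    · rw [if_pos hj] at h
      rw [if_pos (show ((j : ℕ) + 1 = n + 1) by rw [hj, Fin.val_last])]
      exact h
    · rw [if_neg hj] at h
      rw [if_neg (show ¬ ((j : ℕ) + 1 = n + 1) from fun h' => hj (Fin.ext (by rw [Fin.val_last]; omega)))]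
      exact h
  unfold thinIndicatorGL
  rw [if_pos hmem]

/-- **Off the thin shell the thin indicator of `(diag a k)_f` is `0`.** [folklore] -/
theorem thinIndicatorGL_sndHom_torusPoint_eq_zero_of_not
    (p : (Fin (n + 1) → ideleGroup K) × ↥(maximalCompactAdelic (n + 1) K))
    (hc : ¬ ∀ v ∈ T, ∀ j : Fin (n + 1),
      Valued.v (((localComponent v (torusPoint (n + 1) K p) : GL (Fin (n + 1)) (v.adicCompletion K)) :
          Matrix (Fin (n + 1)) (Fin (n + 1)) (v.adicCompletion K)) (Fin.last n) j -
        if j = Fin.last n then 1 else 0) ≤ exp (-(m : ℤ))) :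
    thinIndicatorGL (n + 1) K T m (GLn.sndHom (n + 1) K (torusPoint (n + 1) K p)) = 0 := by
  have hmem : finLastRow (n + 1) K (GLn.sndHom (n + 1) K (torusPoint (n + 1) K p)) ∉ thinFiniteBox (n + 1) K T m := by
    rw [finLastRow_sndHom, mem_thinFiniteBox_iff]
    rintro ⟨-, h2⟩
    apply hc
    intro v hv j
    have h := h2 v hv j
    rw [ThinLastRowTorusPoint.lastRow_succ_apply_adicComponent] at h
    by_cases hj : j = Fin.last n
    · rw [if_pos (show ((j : ℕ) + 1 = n + 1) by rw [hj, Fin.val_last])] at h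
      rw [if_pos hj]
      exact h
    · rw [if_neg (show ¬ ((j : ℕ) + 1 = n + 1) from fun h' => hj (Fin.ext (by rw [Fin.val_last]; omega)))] at h
      rw [if_neg hj]
      exact h
  unfold thinIndicatorGL
  rw [if_neg hmem]

end Thin

/-! ### The registered stub -/

/-- **STUB (W4a, engineering) — support collapse and product form of the translated thin pair integrand
on the unit box (abstract in `W`, `W'`).** Let `W`, `W'` be left `ψ`-equivariant functions on `GL_{n+1}(𝔸_K)`
(`W` central up to modulus one), right invariant under `K_f(𝔫)` with the primes of `𝔫` in `T`, `W` spread at every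
`v ∈ T` with the depth-`m` inequality and `W'` right `K_v(𝔭^M)`-invariant there; let `τ` be a torus element
trivial at the places of `T`, and `I(Φ_∞, s)` the pair torus integrand of
`(W(diag τ ·), W̄'(diag τ ·), thinTestFun Φ_∞ T m)`. Then (i) `∫_{B({v ∉ T}) × K} I = ∫_{B(all) × K} I`
(`setIntegral_translate_thin_eq_unitBox_univ`), and (ii) on `B(all) × K`,
`I(p) = F((diag a k)_f) · W(diag τ · (diag a k)_∞) W̄'(diag τ · (diag a k)_∞) Φ_∞(e (diag a k)_∞) |det|^s δ⁻¹`
with `F = 𝟙_{thin} · ∏_{v ∈ T} 𝟙[(·)_v ∈ N_v K♯_v] : GL_{n+1}(𝔸_K^∞) → {0, 1}` right `K_f(𝔪)`-invariant,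
`𝔪 = ∏_{v ∈ T} 𝔭_v^m`, and `F(1) = 1` (`pair_apply_mul_ofLocal_eq` at each `v ∈ T`, peeled by `pair_eq_prod_mul_pair`;
`thinTestFun_lastRow_torusPoint_succ_eq_of_forall`, `torusWeightC_eq_archTorusWeightC`).
[cite: JacquetPiatetskiShapiroShalika1983, §2 (2.7)] [cite: CogdellAnalyticTheory2004, §4.1] -/
theorem stub_unitBox_translate_productForm :
    ∀ {n : ℕ} {K : Type} [Field K] [NumberField K]
      [MeasurableSpace (AdeleRing (𝓞 K) K)] [BorelSpace (AdeleRing (𝓞 K) K)]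
      (W W' : GL (Fin (n + 1)) (AdeleRing (𝓞 K) K) → ℂ)
      (_ : ∀ (u : ↥(adelicUnipotent (n + 1) K)) (g : GL (Fin (n + 1)) (AdeleRing (𝓞 K) K)), W ((u : GL (Fin (n + 1)) (AdeleRing (𝓞 K) K)) * g) = whittakerCharFun (adeleAddChar K) u * W g)
      (_ : ∀ (u : ↥(adelicUnipotent (n + 1) K)) (g : GL (Fin (n + 1)) (AdeleRing (𝓞 K) K)), W' ((u : GL (Fin (n + 1)) (AdeleRing (𝓞 K) K)) * g) = whittakerCharFun (adeleAddChar K) u * W' g)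
      (_ : ∀ (z : ideleGroup K) (g : GL (Fin (n + 1)) (AdeleRing (𝓞 K) K)), ‖W (Matrix.GeneralLinearGroup.scalar (Fin (n + 1)) z * g)‖ = ‖W g‖)
      {𝔫 : Ideal (𝓞 K)} (_ : 𝔫 ≠ 0)
      (_ : ∀ u ∈ finitePrincipalCongruenceLevel (n + 1) K 𝔫, ∀ g : GL (Fin (n + 1)) (AdeleRing (𝓞 K) K), W (g * GLn.ofFinite (n + 1) K u) = W g)
      (_ : ∀ u ∈ finitePrincipalCongruenceLevel (n + 1) K 𝔫, ∀ g : GL (Fin (n + 1)) (AdeleRing (𝓞 K) K), W' (g * GLn.ofFinite (n + 1) K u) = W' g)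
      {T : Finset (HeightOneSpectrum (𝓞 K))} (_ : ∀ w : HeightOneSpectrum (𝓞 K), w.asIdeal ∣ 𝔫 → w ∈ T) {m : ℕ} (_ : 1 ≤ m)
      (τ : Fin (n + 1) → ideleGroup K) (_ : lastEntry τ = 1) (_ : ∀ v ∈ T, localComponent v (glDiagonal (n + 1) (AdeleRing (𝓞 K) K) τ) = 1)
      (_ : ∀ v ∈ T, ∃ (tv : Fin (n + 1) → (v.adicCompletion K)ˣ) (M c₀ : ℤ),
          IsSpreadWhittakerAt v (adeleAddChar K) tv M (W) ∧
          (∃ y : v.adicCompletion K, Valued.v y ≤ exp (1 - c₀) ∧ (adeleAddChar K).adicComponent v y ≠ 1) ∧ 1 ≤ M ∧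
          (∀ i j : Fin (n + 1), i ≤ j → Valued.v (tv j : v.adicCompletion K) ≤ Valued.v (tv i : v.adicCompletion K)) ∧
          (∀ i j : Fin (n + 1), (i : ℕ) + 1 = j → exp (M - c₀) * Valued.v (tv j : v.adicCompletion K) ≤ Valued.v (tv i : v.adicCompletion K)) ∧
          exp (-(m : ℤ)) * Valued.v (tv 0 : v.adicCompletion K) ≤ exp (-M) * Valued.v (tv (Fin.last n) : v.adicCompletion K) ∧
          ∀ κ ∈ valuedCongruenceSubgroup (Fin (n + 1)) (exp (-M)), ∀ g : GL (Fin (n + 1)) (AdeleRing (𝓞 K) K),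
            W' (g * GLn.ofLocal (n + 1) K v κ) = W' g)
      (νA : Measure (Fin (n + 1) → ideleGroup K)) (νK : Measure ↥(maximalCompactAdelic (n + 1) K)),
    let I : ((Fin (n + 1) → InfiniteAdeleRing K) → ℝ) → ℂ → (Fin (n + 1) → ideleGroup K) × ↥(maximalCompactAdelic (n + 1) K) → ℂ :=
      fun Φinf s => torusPairIntegrandC (n + 1) K (fun g => W (glDiagonal (n + 1) (AdeleRing (𝓞 K) K) τ * g)) (fun g => star W' (glDiagonal (n + 1) (AdeleRing (𝓞 K) K) τ * g))
        (thinTestFun (n + 1) K Φinf T m) s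
    ∃ (𝔪 : Ideal (𝓞 K)) (_ : 𝔪 ≠ 0) (F : GL (Fin (n + 1)) (FiniteAdeleRing (𝓞 K) K) → ℂ),
      (∀ g ∈ glFiniteIntegralLevel (n + 1) K, ∀ u ∈ finitePrincipalCongruenceLevel (n + 1) K 𝔪, F (g * u) = F g) ∧
      (∀ g, F g = 0 ∨ F g = 1) ∧ F 1 = 1 ∧
      ∀ (Φinf : (Fin (n + 1) → InfiniteAdeleRing K) → ℝ) (s : ℂ),
        (∫ p in unitBox {v | v ∉ (↑T : Set (HeightOneSpectrum (𝓞 K)))} ×ˢ Set.univ, I Φinf s p ∂(νA.prod νK) =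
          ∫ p in unitBox (Set.univ : Set (HeightOneSpectrum (𝓞 K))) ×ˢ Set.univ, I Φinf s p ∂(νA.prod νK)) ∧
        ∀ p : (Fin (n + 1) → ideleGroup K) × ↥(maximalCompactAdelic (n + 1) K),
          p.1 ∈ unitBox (n := n + 1) (K := K) (Set.univ : Set (HeightOneSpectrum (𝓞 K))) →
          I Φinf s p = F (GLn.sndHom (n + 1) K (torusPoint (n + 1) K p)) *
            (W (glDiagonal (n + 1) (AdeleRing (𝓞 K) K) τ * GLn.ofInfinite (n + 1) K (GLn.toMixed (n + 1) K (torusPoint (n + 1) K p))) *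
            conj (W' (glDiagonal (n + 1) (AdeleRing (𝓞 K) K) τ * GLn.ofInfinite (n + 1) K (GLn.toMixed (n + 1) K (torusPoint (n + 1) K p)))) *
            ((Φinf (archLastRow (n + 1) K (GLn.toMixed (n + 1) K (torusPoint (n + 1) K p))) : ℝ) : ℂ) *
            archTorusWeightC (n + 1) K s (archTorusOfIdele (n + 1) K p.1)) := by
  intro n K _ _ _ _ W W' hWN hW'N hWZ 𝔫 h𝔫 hWK hW'K T hT m hm τ hτ hτT hsp νA νK
  dsimp only
  choose tv M c₀ hspW hψv hM1 hmono hgap hmt hW'Kv using hsp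
  -- the level `𝔪 = ∏_{v ∈ T} 𝔭_v^m`
  have h𝔪0 : (∏ v ∈ T, v.asIdeal ^ m : Ideal (𝓞 K)) ≠ 0 := prod_pow_asIdeal_ne_zero T m
  have h𝔪rad : ∀ v ∈ T, idealRadius K v (∏ w ∈ T, w.asIdeal ^ m) ≤ exp (-(m : ℤ)) := fun v hv =>
    idealRadius_prod_pow_le m hv
  -- the local indicators `J_v = 𝟙[· ∈ N_v K♯_v]` (`1` off `T`)
  set J : (v : HeightOneSpectrum (𝓞 K)) → GL (Fin (n + 1)) (v.adicCompletion K) → ℂ := fun v x =>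
    if hv : v ∈ T then
      (if ∃ u ∈ upperUnitriangular (Fin (n + 1)) (v.adicCompletion K), ∃ k : GL (Fin (n + 1)) (v.adicCompletion K),
          (k ∈ valuedCongruenceSubgroup (Fin (n + 1)) (exp (-(M v hv))) ∧
            ∀ g : GL (Fin (n + 1)) (AdeleRing (𝓞 K) K), W (g * GLn.ofLocal (n + 1) K v k) = W g) ∧ x = u * k
        then 1 else 0)
    else 1 with hJdef
  have hJ : ∀ v ∈ T, ∀ g' : GL (Fin (n + 1)) (AdeleRing (𝓞 K) K), localComponent v g' = 1 →
      ∀ x : GL (Fin (n + 1)) (v.adicCompletion K),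
        (∀ j : Fin (n + 1), Valued.v ((x : Matrix (Fin (n + 1)) (Fin (n + 1)) (v.adicCompletion K)) (Fin.last n) j -
          if j = Fin.last n then 1 else 0) ≤ exp (-(m : ℤ))) →
        W (g' * GLn.ofLocal (n + 1) K v x) * star (W' (g' * GLn.ofLocal (n + 1) K v x)) =
          J v x * (W g' * star (W' g')) := by
    intro v hv g' hg' x hx
    simp only [hJdef, dif_pos hv]
    exact pair_apply_mul_ofLocal_eq hWN hW'N (hspW v hv) (hψv v hv) (hM1 v hv) (hmono v hv) (hgap v hv) (hmt v hv)
      (hW'Kv v hv) hg' hx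
  have hJ01 : ∀ v ∈ T, ∀ x : GL (Fin (n + 1)) (v.adicCompletion K), J v x = 0 ∨ J v x = 1 := by
    intro v hv x
    simp only [hJdef, dif_pos hv]
    split_ifs
    · exact Or.inr rfl
    · exact Or.inl rfl
  refine ⟨∏ v ∈ T, v.asIdeal ^ m, h𝔪0,
    fun κ => thinIndicatorGL (n + 1) K T m κ * ∏ v ∈ T, J v (localComponent v (GLn.ofFinite (n + 1) K κ)),
    ?_, ?_, ?_, fun Φinf s => ⟨?_, ?_⟩⟩
  · -- right `K_f(𝔪)`-invariance
    intro g _ u hu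
    have hu' : ∀ v ∈ T, localComponent v (GLn.ofFinite (n + 1) K u) ∈
        valuedCongruenceSubgroup (Fin (n + 1)) (exp (-(m : ℤ))) := fun v hv =>
      valuedCongruenceSubgroup_mono (Fin (n + 1)) (h𝔪rad v hv)
        (((mem_principalCongruenceLevel_iff).1 (mem_finitePrincipalCongruenceLevel_iff.1 hu)).2 v)
    dsimp only
    rw [thinIndicatorGL_mul_of_mem_finitePrincipalCongruenceLevel h𝔪rad g hu]
    congr 1
    refine Finset.prod_congr rfl fun v hv => ?_
    rw [map_mul, localComponent_mul]
    simp only [hJdef, dif_pos hv]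
    exact if_congr (exists_sharp_mul_iff (hspW v hv) (hmono v hv) (hmt v hv) _ (hu' v hv)) rfl rfl
  · -- values in `{0, 1}`
    intro g
    exact mul_eq_zero_or_one (thinIndicatorGL_eq_zero_or_one T m g)
      (prod_eq_zero_or_one T fun v hv => hJ01 v hv _)
  · -- `F(1) = 1`
    dsimp only
    rw [thinIndicatorGL_one, one_mul]
    refine Finset.prod_eq_one fun v hv => ?_
    rw [map_one, localComponent_one]
    simp only [hJdef, dif_pos hv]
    rw [if_pos]
    exact ⟨1, one_mem _, 1, ⟨one_mem _, fun g => by rw [map_one, mul_one]⟩, (one_mul _).symm⟩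
  · -- (i) the support collapse
    exact setIntegral_translate_thin_eq_unitBox_univ hWN hWZ hm τ hτ hτT
      (fun v hv => ⟨tv v hv, M v hv, c₀ v hv, hspW v hv, hψv v hv, hM1 v hv, hmono v hv, hgap v hv, hmt v hv⟩)
      _ Φinf s νA νK
  · -- (ii) the product form on the unit box
    rintro ⟨a, k⟩ ha
    dsimp only at ha ⊢
    set tp : GL (Fin (n + 1)) (AdeleRing (𝓞 K) K) := torusPoint (n + 1) K (a, k) with htp
    set g₀ : GL (Fin (n + 1)) (AdeleRing (𝓞 K) K) :=
      glDiagonal (n + 1) (AdeleRing (𝓞 K) K) τ * GLn.ofInfinite (n + 1) K (GLn.toMixed (n + 1) K tp) with hg₀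
    simp only [torusPairIntegrandC, Pi.star_apply]
    by_cases hc : ∀ v ∈ T, ∀ j : Fin (n + 1),
        Valued.v (((localComponent v tp : GL (Fin (n + 1)) (v.adicCompletion K)) :
            Matrix (Fin (n + 1)) (Fin (n + 1)) (v.adicCompletion K)) (Fin.last n) j -
          if j = Fin.last n then 1 else 0) ≤ exp (-(m : ℤ))
    · have hthin : thinTestFun (n + 1) K Φinf T m (lastRow (n + 1) K tp) =
          Φinf (archLastRow (n + 1) K (GLn.toMixed (n + 1) K tp)) :=
        ThinLastRowTorusPoint.thinTestFun_lastRow_torusPoint_succ_eq_of_forall Φinf ha k hc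
      have hind : thinIndicatorGL (n + 1) K T m (GLn.sndHom (n + 1) K tp) = 1 :=
        thinIndicatorGL_sndHom_torusPoint_eq_one_of_forall ha k hc
      have hwt : torusWeightC (n + 1) K s a = archTorusWeightC (n + 1) K s (archTorusOfIdele (n + 1) K a) :=
        torusWeightC_eq_archTorusWeightC s ha
      -- hypotheses of the peeling at `S = T`
      have h1 : ∀ v ∈ T, localComponent v g₀ = 1 := fun v hv => by
        rw [hg₀, localComponent_mul, hτT v hv, localComponent_ofInfinite, one_mul]
      have h3 : ∀ w, w ∉ T → (localComponent w g₀)⁻¹ * localComponent w (glDiagonal (n + 1) (AdeleRing (𝓞 K) K) τ * tp) ∈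
          valuedCongruenceSubgroup (Fin (n + 1)) (1 : ℤᵐ⁰) := fun w _ => by
        rw [hg₀, localComponent_mul, localComponent_mul, localComponent_ofInfinite, mul_one, ← mul_assoc,
          inv_mul_cancel, one_mul, ← glInt_adicCompletion_eq]
        exact localComponent_torusPoint_mem_glInt (fun i => ha w (Set.mem_univ w) i) k
      have h4 : GLn.fstHom (n + 1) K (glDiagonal (n + 1) (AdeleRing (𝓞 K) K) τ * tp) = GLn.fstHom (n + 1) K g₀ := by
        rw [hg₀, map_mul, map_mul, GLn.fstHom_ofInfinite, GLn.toMixed_apply, MulEquiv.symm_apply_apply]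
      have h5 : ∀ v ∈ T, ∀ j : Fin (n + 1),
          Valued.v (((localComponent v (glDiagonal (n + 1) (AdeleRing (𝓞 K) K) τ * tp) : GL (Fin (n + 1)) (v.adicCompletion K)) :
              Matrix (Fin (n + 1)) (Fin (n + 1)) (v.adicCompletion K)) (Fin.last n) j -
            if j = Fin.last n then 1 else 0) ≤ exp (-(m : ℤ)) := fun v hv j => by
        rw [localComponent_mul, hτT v hv, one_mul]
        exact hc v hv j
      have hkey := pair_eq_prod_mul_pair h𝔫 hWK hW'K hT J hJ T subset_rfl
        (glDiagonal (n + 1) (AdeleRing (𝓞 K) K) τ * tp) g₀ h1 (fun w hw hw' => absurd hw' hw) h3 h4 h5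
      have hprod : (∏ v ∈ T, J v (localComponent v (GLn.ofFinite (n + 1) K (GLn.sndHom (n + 1) K tp)))) =
          ∏ v ∈ T, J v (localComponent v (glDiagonal (n + 1) (AdeleRing (𝓞 K) K) τ * tp)) :=
        Finset.prod_congr rfl fun v hv => by rw [localComponent_ofFinite_sndHom, localComponent_mul, hτT v hv, one_mul]
      rw [hthin, hwt, hind, one_mul, hprod, hkey, hg₀]
      simp only [starRingEnd_apply]
      ring
    · have hthin : thinTestFun (n + 1) K Φinf T m (lastRow (n + 1) K tp) = 0 :=
        ThinLastRowTorusPoint.thinTestFun_lastRow_torusPoint_succ_eq_zero Φinf (a, k) hc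
      have hind : thinIndicatorGL (n + 1) K T m (GLn.sndHom (n + 1) K tp) = 0 :=
        thinIndicatorGL_sndHom_torusPoint_eq_zero_of_not (a, k) hc
      rw [hthin, hind, Complex.ofReal_zero, mul_zero, zero_mul, zero_mul, zero_mul]

end Summit.Langlands.Langlands.Theorems.UnitBoxTranslateProductForm
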